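import Summits.RiemannHypothesis.RiemannHypothesis.Theses.LittlewoodRadar
import HarnessLib

/-!
# Route LittlewoodRadar (L52) — the bookkeeping leaf `DoorOfPintz` (item stmt-RiemannHypothesis-24251)

`DoorOfPintz : PintzLocalisation → (θ-radar door)`: GIVEN the explicit Pintz localisation for `ψ`
(item 24249: for every zero `ρ = β + iγ`, `0 < β < 1`, and every `Y` with
`log Y ≥ 10⁴ (1 + log(|γ|+5))` some `x ∈ [Y, Y^{10⁴ log(|γ|+5)}]` has `1.4 x^β/|ρ| < |ψ(x) − x|`),
every zero of offset `|β − 1/2| ≥ η` and height `|γ| ≤ T` (`0 < η ≤ 1/2`, `T ≥ 16`) breaks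
Schoenfeld's RH-envelope `|θ(x) − x| ≤ √x log²x /(8π)` at some `x ∈ [599, exp(10⁹ log²T (1+|log η|)/η)]`.

Proof (pure bookkeeping, RH-free, no new analytic input):
* WLOG `β ≥ 1/2 + η`: otherwise pass to the reflected zero `1 − ρ` (functional equation,
  `GeneralizedRH.riemannZeta_one_sub_eq_zero`), which has real part `1 − β ≥ 1/2 + η` and the same `|γ|`.
* Take `log Y = A + B`, `A = 10⁴ (1 + log(T+5))` (Pintz threshold, monotone in `|γ| ≤ T`),
  `B = (2/η)(log(T+5) + 2|log η| + 3)`; the key estimate `(T+5) L² ≤ e^{ηL}` for `L ≥ B`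
  (`exp_key`) gives, at the Pintz point `x ≥ Y`, `1.4 x^β/|ρ| ≥ 1.4 √x log²x` (as `|ρ| ≤ T + 5`),
  whence with Mathlib's `ψ(x) − θ(x) ≤ 2 √x log x` and `8π > 25`:
  `|θ(x) − x| > 1.4 √x log²x − 2 √x log x ≥ √x log²x/(8π)`.
* Window: `log x ≤ (A + B) · 10⁴ log(T+5) ≤ 1.65·10⁸ log²T + 4.9·10⁴ log²T (1+|log η|)/η ≤ 10⁹ log²T (1+|log η|)/η`
  (`T ≥ 16`: `log T ≥ 2.7725`, `log(T+5) ≤ log T + 5/16`).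

Rung currency only: this is the glue half of the RH-free rung `ThetaRadarDoor ⟸ PintzLocalisation ∧ DoorOfPintz`;
nothing here bears on the truth of RH.
-/

set_option linter.dupNamespace false

noncomputable section

namespace Summit.RiemannHypothesis.RiemannHypothesis.Theorems.LittlewoodRadar

open Real
open Summit.RiemannHypothesis.RiemannHypothesis.Theses.LittlewoodRadar

/-! ## Numerical constants -/

/-- `log 16 ≥ 2.7724`. [folklore] -/
theorem log_sixteen_ge : (2.7724 : ℝ) ≤ Real.log 16 := by
  have h : Real.log 16 = 4 * Real.log 2 := by
    rw [show (16 : ℝ) = 2 ^ 4 by norm_num, Real.log_pow]; norm_num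
  rw [h]; linarith [Real.log_two_gt_d9]

/-- `log T ≥ 2.7724` for `T ≥ 16`. [folklore] -/
theorem log_ge_of_sixteen_le {T : ℝ} (hT : 16 ≤ T) : (2.7724 : ℝ) ≤ Real.log T :=
  log_sixteen_ge.trans (Real.log_le_log (by norm_num) hT)

/-- `log (T + 5) ≤ log T + 5/16` for `T ≥ 16`. [folklore] -/
theorem log_add_five_le {T : ℝ} (hT : 16 ≤ T) : Real.log (T + 5) ≤ Real.log T + 5 / 16 := by
  have hT0 : 0 < T := by linarith
  have h1 : Real.log (T + 5) = Real.log T + Real.log (1 + 5 / T) := by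
    rw [← Real.log_mul hT0.ne' (by positivity)]
    congr 1; field_simp
  have h2 : Real.log (1 + 5 / T) ≤ (1 + 5 / T) - 1 := Real.log_le_sub_one_of_pos (by positivity)
  have h3 : 5 / T ≤ 5 / 16 := div_le_div_of_nonneg_left (by norm_num) (by norm_num) hT
  linarith

/-- `8π > 25`. [folklore] -/
theorem eight_pi_gt : (25 : ℝ) < 8 * Real.pi := by linarith [Real.pi_gt_d2]

/-! ## The key growth estimate -/

/-- For `0 < η ≤ 1/2`, `M ≥ 1` and `L ≥ (2/η)(log M + 2|log η| + 3)`: `M · L² ≤ exp (η L)`.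
(`exp(ηL) = exp(ηL/2)·exp(ηL/4)² ≥ (M η⁻² e³)·(ηL/4)²`.) [folklore] -/
theorem exp_key {η M L : ℝ} (hη : 0 < η) (hη2 : η ≤ 1 / 2) (hM : 1 ≤ M)
    (hL : 2 / η * (Real.log M + 2 * |Real.log η| + 3) ≤ L) : M * L ^ 2 ≤ Real.exp (η * L) := by
  have hM0 : 0 < M := by linarith
  have hlogη : Real.log η < 0 := Real.log_neg hη (by linarith)
  have habs : |Real.log η| = -Real.log η := abs_of_neg hlogη
  have hlogM : 0 ≤ Real.log M := Real.log_nonneg hM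
  -- L ≥ 0
  have hB0 : 0 ≤ 2 / η * (Real.log M + 2 * |Real.log η| + 3) := by positivity
  have hL0 : 0 ≤ L := hB0.trans hL
  -- η L / 2 ≥ log M + 2|log η| + 3
  have hhalf : Real.log M + 2 * |Real.log η| + 3 ≤ η * L / 2 := by
    have := mul_le_mul_of_nonneg_left hL hη.le
    have h' : η * (2 / η * (Real.log M + 2 * |Real.log η| + 3)) = 2 * (Real.log M + 2 * |Real.log η| + 3) := by
      field_simp
    linarith [h' ▸ this]
  -- exp(η L / 2) ≥ M * η⁻² * 16
  have hexp_half : M * (1 / η ^ 2) * 16 ≤ Real.exp (η * L / 2) := by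
    have e1 : Real.exp (Real.log M + 2 * |Real.log η| + 3) ≤ Real.exp (η * L / 2) :=
      Real.exp_le_exp.2 hhalf
    have e2 : Real.exp (Real.log M + 2 * |Real.log η| + 3)
        = M * (1 / η ^ 2) * Real.exp 3 := by
      rw [Real.exp_add, Real.exp_add, Real.exp_log hM0, habs]
      have : Real.exp (2 * -Real.log η) = 1 / η ^ 2 := by
        rw [show 2 * -Real.log η = -(Real.log η + Real.log η) by ring, Real.exp_neg, Real.exp_add,
          Real.exp_log hη]
        field_simp
      rw [this]
    have e3 : (16 : ℝ) ≤ Real.exp 3 := by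
      have h27 : (2.7 : ℝ) ≤ Real.exp 1 := by linarith [Real.exp_one_gt_d9]
      have h3 : Real.exp 3 = Real.exp 1 ^ 3 := by rw [← Real.exp_nat_mul]; norm_num
      have hp := pow_le_pow_left₀ (by norm_num : (0 : ℝ) ≤ 2.7) h27 3
      rw [h3]; norm_num at hp; linarith
    have hpos : 0 ≤ M * (1 / η ^ 2) := by positivity
    calc M * (1 / η ^ 2) * 16 ≤ M * (1 / η ^ 2) * Real.exp 3 := by gcongr
      _ = Real.exp (Real.log M + 2 * |Real.log η| + 3) := e2.symm
      _ ≤ Real.exp (η * L / 2) := e1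
  -- exp(η L / 4) ≥ η L / 4
  have hquarter : η * L / 4 ≤ Real.exp (η * L / 4) := by linarith [Real.add_one_le_exp (η * L / 4)]
  have hq0 : 0 ≤ η * L / 4 := by positivity
  have hsq : (η * L / 4) ^ 2 ≤ Real.exp (η * L / 4) ^ 2 := pow_le_pow_left₀ hq0 hquarter 2
  have hsplit : Real.exp (η * L) = Real.exp (η * L / 2) * Real.exp (η * L / 4) ^ 2 := by
    rw [sq, ← Real.exp_add, ← Real.exp_add]; congr 1; ring
  rw [hsplit]
  calc M * L ^ 2 = (M * (1 / η ^ 2) * 16) * (η * L / 4) ^ 2 := by field_simp; ring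
    _ ≤ Real.exp (η * L / 2) * Real.exp (η * L / 4) ^ 2 := by
        gcongr

/-! ## The envelope is beaten at a Pintz point -/

/-- If `x ≥ 599`, `(T+5)·log²x ≤ x^η`, `|ρ| ≤ T + 5`, `0 < |ρ|`, `β ≥ 1/2 + η` and
`1.4 x^β/|ρ| < |ψ(x) − x|`, then `√x log²x/(8π) < |θ(x) − x|`. [folklore] -/
theorem envelope_broken {x η T β : ℝ} {ρ : ℂ} (hx : 599 ≤ x)
    (hkey : (T + 5) * Real.log x ^ 2 ≤ Real.exp (η * Real.log x))
    (hρ : ‖ρ‖ ≤ T + 5) (hρ0 : 0 < ‖ρ‖) (hβ : 1 / 2 + η ≤ β)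
    (hP : 1.4 * x ^ β / ‖ρ‖ < |Chebyshev.psi x - x|) :
    Real.sqrt x * Real.log x ^ 2 / (8 * Real.pi) < |Chebyshev.theta x - x| := by
  have hx0 : 0 < x := by linarith
  have hx1 : 1 ≤ x := by linarith
  have hL : 6 ≤ Real.log x := by
    rw [Real.le_log_iff_exp_le hx0]
    have h6 : Real.exp 6 = Real.exp 1 ^ 6 := by rw [← Real.exp_nat_mul]; norm_num
    rw [h6]
    have := Real.exp_one_lt_d9
    have h0 := Real.exp_pos (1 : ℝ)
    nlinarith [pow_le_pow_left₀ h0.le this.le 6]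
  set L := Real.log x with hLdef
  have hsx : 0 < Real.sqrt x := Real.sqrt_pos.2 hx0
  -- x^β ≥ √x · x^η ≥ √x (T+5) L²
  have hxη : x ^ η = Real.exp (η * L) := by rw [Real.rpow_def_of_pos hx0, mul_comm]
  have hxβ : Real.sqrt x * ((T + 5) * L ^ 2) ≤ x ^ β := by
    calc Real.sqrt x * ((T + 5) * L ^ 2) ≤ Real.sqrt x * x ^ η := by
            gcongr; rw [hxη]; exact hkey
      _ = x ^ (1 / 2 + η) := by rw [Real.sqrt_eq_rpow, ← Real.rpow_add hx0]
      _ ≤ x ^ β := Real.rpow_le_rpow_of_exponent_le hx1 hβ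
  -- 1.4 √x L² ≤ 1.4 x^β / |ρ|
  have hmain : 1.4 * Real.sqrt x * L ^ 2 ≤ 1.4 * x ^ β / ‖ρ‖ := by
    rw [le_div_iff₀ hρ0]
    have : Real.sqrt x * L ^ 2 * ‖ρ‖ ≤ Real.sqrt x * L ^ 2 * (T + 5) := by gcongr
    nlinarith [hxβ, this]
  -- ψ − θ ≤ 2 √x log x
  have hpt : Chebyshev.psi x - Chebyshev.theta x ≤ 2 * Real.sqrt x * L := Chebyshev.psi_sub_theta_le hx1
  have htri : |Chebyshev.psi x - x| - (Chebyshev.psi x - Chebyshev.theta x) ≤ |Chebyshev.theta x - x| := by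
    have := abs_sub_abs_le_abs_sub (Chebyshev.psi x - x) (Chebyshev.theta x - x)
    have h2 : |Chebyshev.psi x - x - (Chebyshev.theta x - x)| = Chebyshev.psi x - Chebyshev.theta x := by
      rw [show Chebyshev.psi x - x - (Chebyshev.theta x - x) = Chebyshev.psi x - Chebyshev.theta x by ring]
      exact abs_of_nonneg (by linarith [Chebyshev.theta_le_psi x])
    linarith
  -- √x L²/(8π) ≤ √x L²/25 < 1.4 √x L² − 2 √x L
  have h8 : Real.sqrt x * L ^ 2 / (8 * Real.pi) ≤ Real.sqrt x * L ^ 2 / 25 :=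
    div_le_div_of_nonneg_left (by positivity) (by norm_num) eight_pi_gt.le
  have hgap : Real.sqrt x * L ^ 2 / 25 < 1.4 * Real.sqrt x * L ^ 2 - 2 * Real.sqrt x * L := by
    have : 0 < Real.sqrt x * L := by positivity
    nlinarith
  linarith

/-! ## Window budget -/

/-- The window exponent fits the typed budget. [folklore] -/
theorem window_budget {η T : ℝ} (hη : 0 < η) (hη2 : η ≤ 1 / 2) (hT : 16 ≤ T) :
    (10 ^ 4 * (1 + Real.log (T + 5)) + 2 / η * (Real.log (T + 5) + 2 * |Real.log η| + 3))
        * (10 ^ 4 * Real.log (T + 5))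
      ≤ 10 ^ 9 * Real.log T ^ 2 * (1 + |Real.log η|) / η := by
  have hℓ := log_ge_of_sixteen_le hT
  have hℓ5 := log_add_five_le hT
  set ℓ := Real.log T
  set ℓ5 := Real.log (T + 5)
  set m := |Real.log η|
  have hm : 0 ≤ m := abs_nonneg _
  have hℓ50 : 0 ≤ ℓ5 := Real.log_nonneg (by linarith)
  have hu : 2 ≤ 1 / η := by rw [le_div_iff₀ hη]; linarith
  set u := 1 / η with hu_def
  have hu0 : 0 < u := by positivity
  -- rewrite divisions by η as multiplication by u
  have e1 : 2 / η = 2 * u := by rw [hu_def]; field_simp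
  have e2 : 10 ^ 9 * ℓ ^ 2 * (1 + m) / η = 10 ^ 9 * ℓ ^ 2 * (1 + m) * u := by rw [hu_def]; field_simp
  rw [e1, e2]
  -- elementary bounds in terms of ℓ
  have b1 : ℓ5 ≤ 1.113 * ℓ := by nlinarith
  have b2 : 1 + ℓ5 ≤ 1.474 * ℓ := by nlinarith
  have b3 : ℓ5 + 2 * m + 3 ≤ 2.196 * ℓ * (1 + m) := by nlinarith
  have hℓ0 : 0 < ℓ := by linarith
  -- first summand
  have s1 : 10 ^ 4 * (1 + ℓ5) * (10 ^ 4 * ℓ5) ≤ 1.6406 * 10 ^ 8 * ℓ ^ 2 := by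
    have : (1 + ℓ5) * ℓ5 ≤ (1.474 * ℓ) * (1.113 * ℓ) := by
      apply mul_le_mul b2 b1 hℓ50; positivity
    nlinarith
  -- second summand
  have s2 : 2 * u * (ℓ5 + 2 * m + 3) * (10 ^ 4 * ℓ5) ≤ 4.89 * 10 ^ 4 * (ℓ ^ 2 * (1 + m) * u) := by
    have : (ℓ5 + 2 * m + 3) * ℓ5 ≤ (2.196 * ℓ * (1 + m)) * (1.113 * ℓ) := by
      apply mul_le_mul b3 b1 hℓ50; positivity
    have hP0 : 0 ≤ ℓ ^ 2 * (1 + m) * u := by positivity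
    calc 2 * u * (ℓ5 + 2 * m + 3) * (10 ^ 4 * ℓ5)
        = (2 * u * 10 ^ 4) * ((ℓ5 + 2 * m + 3) * ℓ5) := by ring
      _ ≤ (2 * u * 10 ^ 4) * ((2.196 * ℓ * (1 + m)) * (1.113 * ℓ)) := by gcongr
      _ = 48882.96 * (ℓ ^ 2 * (1 + m) * u) := by ring
      _ ≤ 4.89 * 10 ^ 4 * (ℓ ^ 2 * (1 + m) * u) := by
          apply mul_le_mul_of_nonneg_right _ hP0; norm_num
  -- ℓ² ≤ ℓ²(1+m)u/2
  have s3 : ℓ ^ 2 ≤ ℓ ^ 2 * (1 + m) * u / 2 := by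
    have : ℓ ^ 2 * 2 ≤ ℓ ^ 2 * ((1 + m) * u) := by
      apply mul_le_mul_of_nonneg_left _ (by positivity)
      nlinarith
    linarith
  have hP : 0 ≤ ℓ ^ 2 * (1 + m) * u := by positivity
  nlinarith

/-! ## The door -/

/-- Core: a zero with `β ≥ 1/2 + η`, `|γ| ≤ T` breaks the envelope inside the window. [folklore] -/
theorem door_core (hP : PintzLocalisation) {η T : ℝ} (hη : 0 < η) (hη2 : η ≤ 1 / 2) (hT : 16 ≤ T)
    {ρ : ℂ} (hζ : riemannZeta ρ = 0) (h0 : 0 < ρ.re) (h1 : ρ.re < 1) (hγ : |ρ.im| ≤ T)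
    (hβ : 1 / 2 + η ≤ ρ.re) :
    ∃ x : ℝ, 599 ≤ x ∧ x ≤ Real.exp (10 ^ 9 * Real.log T ^ 2 * (1 + |Real.log η|) / η) ∧
      Real.sqrt x * Real.log x ^ 2 / (8 * Real.pi) < |Chebyshev.theta x - x| := by
  set A : ℝ := 10 ^ 4 * (1 + Real.log (T + 5)) with hA
  set B : ℝ := 2 / η * (Real.log (T + 5) + 2 * |Real.log η| + 3) with hB
  have hℓ5 : 0 ≤ Real.log (T + 5) := Real.log_nonneg (by linarith)
  have hγ5 : 1 ≤ |ρ.im| + 5 := by linarith [abs_nonneg ρ.im]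
  have hlogγ : Real.log (|ρ.im| + 5) ≤ Real.log (T + 5) :=
    Real.log_le_log (by linarith [abs_nonneg ρ.im]) (by linarith)
  have hlogγ0 : 0 ≤ Real.log (|ρ.im| + 5) := Real.log_nonneg hγ5
  have hA0 : 0 ≤ A := by positivity
  have hB0 : 0 ≤ B := by positivity
  -- the Pintz point
  set Y : ℝ := Real.exp (A + B) with hY
  have hY0 : 0 < Y := Real.exp_pos _
  have hlogY : Real.log Y = A + B := Real.log_exp _
  have hthr : 10 ^ 4 * (1 + Real.log (|ρ.im| + 5)) ≤ Real.log Y := by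
    rw [hlogY]; nlinarith
  obtain ⟨x, hYx, hxY, hPx⟩ := hP ρ hζ h0 h1 Y hthr
  have hx0 : 0 < x := lt_of_lt_of_le hY0 hYx
  -- log x ≥ A + B
  have hlogx : A + B ≤ Real.log x := by
    rw [← hlogY]; exact Real.log_le_log hY0 hYx
  -- x ≥ 599 : log x ≥ A ≥ 10^4
  have hx599 : 599 ≤ x := by
    have hlx : (7 : ℝ) ≤ Real.log x := by nlinarith
    have : Real.exp 7 ≤ x := by rwa [← Real.le_log_iff_exp_le hx0]
    have h7 : (599 : ℝ) ≤ Real.exp 7 := by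
      have h27 : (2.7 : ℝ) ≤ Real.exp 1 := by linarith [Real.exp_one_gt_d9]
      have e7 : Real.exp 7 = Real.exp 1 ^ 7 := by rw [← Real.exp_nat_mul]; norm_num
      have hp := pow_le_pow_left₀ (by norm_num : (0 : ℝ) ≤ 2.7) h27 7
      rw [e7]; norm_num at hp; linarith
    linarith
  refine ⟨x, hx599, ?_, ?_⟩
  · -- window
    have hxle : Real.log x ≤ 10 ^ 4 * Real.log (|ρ.im| + 5) * (A + B) := by
      have := Real.log_le_log hx0 hxY
      rwa [Real.log_rpow hY0, hlogY] at this
    have hxle' : Real.log x ≤ (A + B) * (10 ^ 4 * Real.log (T + 5)) :=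
      calc Real.log x ≤ 10 ^ 4 * Real.log (|ρ.im| + 5) * (A + B) := hxle
        _ ≤ 10 ^ 4 * Real.log (T + 5) * (A + B) := by gcongr
        _ = (A + B) * (10 ^ 4 * Real.log (T + 5)) := by ring
    have hbud := window_budget hη hη2 hT
    rw [← Real.exp_log hx0]
    exact Real.exp_le_exp.2 (hxle'.trans hbud)
  · -- envelope
    have hρn : ‖ρ‖ ≤ T + 5 := by
      have h := Complex.norm_le_abs_re_add_abs_im ρ
      have : |ρ.re| < 1 := by rw [abs_lt]; constructor <;> linarith
      linarith
    have hρ0 : 0 < ‖ρ‖ := by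
      rw [norm_pos_iff]; intro h; rw [h] at h0; simp at h0
    have hkey : (T + 5) * Real.log x ^ 2 ≤ Real.exp (η * Real.log x) :=
      exp_key (M := T + 5) hη hη2 (by linarith) (hB ▸ (le_of_add_le_of_nonneg_right hlogx hA0))
    exact envelope_broken hx599 hkey hρn hρ0 hβ hPx

/-- **`DoorOfPintz` (item stmt-RiemannHypothesis-24251).** [folklore] -/
theorem doorOfPintz_proof : DoorOfPintz := by
  intro hP η T hη hη2 hT s hs h0 h1 hγ hoff
  by_cases hβ : 1 / 2 ≤ s.re
  · -- β ≥ 1/2: offset gives β ≥ 1/2 + η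
    have hβ' : 1 / 2 + η ≤ s.re := by
      rw [abs_of_nonneg (by linarith)] at hoff; linarith
    exact door_core hP hη hη2 hT hs h0 h1 hγ hβ'
  · -- β < 1/2: reflect
    rw [not_le] at hβ
    have hs' := Literature.NumberTheory.LFunctions.GeneralizedRH.riemannZeta_one_sub_eq_zero hs h0 h1
    have hre : (1 - s).re = 1 - s.re := by simp
    have him : (1 - s).im = -s.im := by simp
    have hβ' : 1 / 2 + η ≤ (1 - s).re := by
      rw [hre]; rw [abs_of_neg (by linarith)] at hoff; linarith
    exact door_core hP hη hη2 hT hs' (by rw [hre]; linarith) (by rw [hre]; linarith)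
      (by rw [him, abs_neg]; exact hγ) hβ'

end Summit.RiemannHypothesis.RiemannHypothesis.Theorems.LittlewoodRadar

end
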